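import Summits.AtomisticToContinuum.BoseEinsteinCondensation.Theorems.BoxCountShadow
import Literature.MathematicalPhysics.QuantumManyBody.LiebYngvasonTheorem
import Literature.MathematicalPhysics.QuantumManyBody.BoseGasSubcellCondensationDilute
import HarnessLib

/-!
# BoxCountShadowCellFloor — per-cell energy floors at the horizon scale (S2a of the CoercivityLine)

Pure-real minorant bookkeeping and the per-cell lower bounds for the Neumann energies `E₀^N(m, ℓ)` of the horizon
cells (`ℓ = L/K`, expected count `λ = N/K³ = ρℓ³`), from two PROVED tree theorems: LSSY Theorem 2.4
`LSSY2005_lowerBound_neumann_holds` (relative fillings `x = m/λ ∈ [x_lo, 9]`: `cell_lowerBound_quadratic`) and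
superadditivity `LSSY2005_superadditivity_holds` (iterated with block size `p = ⌈8λ⌉`, for `x > 8`:
`cell_lowerBound_linear`), combined in `cell_lowerBound_gauge` through the convex minorant `cellGauge`
(`g(x) = x²` for `x ≤ 8`, `2x` beyond) with `g(x) ≥ (2x − 1) + min((x − 1)², 1)` (`cellGauge_ge`) and the
Σ-bookkeeping `Σ_B x_B = K³ ⇒ K³(1 + Σ_B K⁻³ min((x_B−1)²,1)) ≤ Σ_B g(x_B)` (`sum_cellGauge_ge`); plus the smallness of
the LSSY parameters in the dilute limit (`cellProfileParams_eventually`).  The hypotheses of the per-cell lemmas carry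
Theorem 2.4's constants `(δ, C, C')`, the error `err` and the sparse cutoff `x_lo` as EXPLICIT binders.
No instances, no notation, no sorry.
-/

noncomputable section

open MeasureTheory Filter Set Topology
open scoped ENNReal NNReal BigOperators

namespace Summit.AtomisticToContinuum.BoseEinsteinCondensation.Theorems.BoxCountShadow

open Literature.MathematicalPhysics.QuantumManyBody.BoseGas
open Summit.AtomisticToContinuum.BoseEinsteinCondensation.Theorems.BoxLatticeFSum
open Summit.AtomisticToContinuum.BoseEinsteinCondensation.Theorems.BoxLabelAffinity
open Summit.AtomisticToContinuum.BoseEinsteinCondensation.Theorems.BoxHorizonAffinity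

/-! ### Objects -/

/-- `w_K(m) = Σ_B K⁻³ min((m_B/λ − 1)², 1)`: the truncated-variance weight of a count vector. [folklore] -/
def truncWeight (K : ℕ) (lam : ℝ) (m : SubIdx K → ℕ) : ℝ≥0∞ :=
  ∑ B : SubIdx K, blockWeight K ^ 2 * ENNReal.ofReal (min ((((m B : ℕ) : ℝ) / lam - 1) ^ 2) 1)

/-- The convex minorant `g(x) = x²` (`x ≤ 8`), `2x` (`x > 8`) of the per-cell energy in units `u = 4πaρλ`. [folklore] -/
def cellGauge (x : ℝ) : ℝ := if x ≤ 8 then x ^ 2 else 2 * x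

/-! ### Elementary real lemmas -/

/-- `g ≥ 0` on `x ≥ 0`. [folklore] -/
theorem cellGauge_nonneg {x : ℝ} (hx : 0 ≤ x) : 0 ≤ cellGauge x := by
  unfold cellGauge; split_ifs <;> positivity

/-- `(2x − 1) + min((x−1)², 1) ≤ g(x)` for `x ≥ 0` (equality on `[0,2]`). [folklore] -/
theorem cellGauge_ge {x : ℝ} (hx : 0 ≤ x) : 2 * x - 1 + min ((x - 1) ^ 2) 1 ≤ cellGauge x := by
  unfold cellGauge
  split_ifs with h
  · by_cases h2 : x ≤ 2
    · have : min ((x - 1) ^ 2) 1 ≤ (x - 1) ^ 2 := min_le_left _ _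
      nlinarith
    · have : min ((x - 1) ^ 2) 1 ≤ 1 := min_le_right _ _
      push Not at h2
      nlinarith
  · have : min ((x - 1) ^ 2) 1 ≤ 1 := min_le_right _ _
    push Not at h
    nlinarith

/-- Summed minorant: `K³ (1 + Σ_B K⁻³ min((x_B−1)²,1)) ≤ Σ_B g(x_B)` when `Σ_B x_B = K³`, `x_B ≥ 0`. [folklore] -/
theorem sum_cellGauge_ge {K : ℕ} (hK : 0 < K) (x : SubIdx K → ℝ) (hx : ∀ B, 0 ≤ x B)
    (hsum : ∑ B, x B = (K : ℝ) ^ 3) :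
    (K : ℝ) ^ 3 * (1 + ∑ B, (1 / (K : ℝ)) ^ 3 * min ((x B - 1) ^ 2) 1) ≤ ∑ B, cellGauge (x B) := by
  have hKr : (0 : ℝ) < K := Nat.cast_pos.2 hK
  have hK3 : (K : ℝ) ^ 3 ≠ 0 := by positivity
  have hcard : ((Finset.univ : Finset (SubIdx K)).card : ℝ) = (K : ℝ) ^ 3 := by
    rw [Finset.card_univ, show Fintype.card (SubIdx K) = K ^ 3 by simp]; push_cast; ring
  calc (K : ℝ) ^ 3 * (1 + ∑ B, (1 / (K : ℝ)) ^ 3 * min ((x B - 1) ^ 2) 1)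
      = (K : ℝ) ^ 3 + ∑ B, min ((x B - 1) ^ 2) 1 := by
        rw [mul_add, mul_one, Finset.mul_sum]
        congr 1
        refine Finset.sum_congr rfl fun B _ => ?_
        field_simp
    _ = ∑ B, (2 * x B - 1 + min ((x B - 1) ^ 2) 1) := by
        rw [Finset.sum_add_distrib, Finset.sum_sub_distrib, ← Finset.mul_sum, hsum, Finset.sum_const,
          nsmul_eq_mul, hcard]
        ring
    _ ≤ ∑ B, cellGauge (x B) := Finset.sum_le_sum fun B _ => cellGauge_ge (hx B)

/-- `(blockWeight K)² = ofReal (K⁻³)`. [folklore] -/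
theorem blockWeight_sq_eq_ofReal (K : ℕ) : blockWeight K ^ 2 = ENNReal.ofReal ((1 / (K : ℝ)) ^ 3) := by
  have h0 : (0 : ℝ) ≤ 1 / (K : ℝ) := by positivity
  rw [blockWeight, ← ENNReal.ofReal_pow (by positivity)]
  congr 1
  rw [← pow_mul, show 3 * 2 = 2 * 3 by norm_num, pow_mul, Real.sq_sqrt h0]

/-- The truncated weight is `ofReal` of the real sum. [folklore] -/
theorem truncWeight_eq_ofReal (K : ℕ) (lam : ℝ) (m : SubIdx K → ℕ) :
    truncWeight K lam m =
      ENNReal.ofReal (∑ B : SubIdx K, (1 / (K : ℝ)) ^ 3 * min ((((m B : ℕ) : ℝ) / lam - 1) ^ 2) 1) := by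
  unfold truncWeight
  rw [ENNReal.ofReal_sum_of_nonneg (fun B _ => by positivity)]
  refine Finset.sum_congr rfl fun B _ => ?_
  rw [blockWeight_sq_eq_ofReal, ← ENNReal.ofReal_mul (by positivity)]

/-! ### Per-cell lower bounds (Theorem 2.4 branch and superadditive branch) -/

section PerCell

variable {v : ℝ → ℝ≥0∞} {a ℓ lam ρ δ C C' err xlo : ℝ}

/-- **Quadratic branch.** For relative fillings `x = m/λ ∈ [x_lo, 9]`, Theorem 2.4 in the cell gives
`E₀^N(m, ℓ) ≥ u (1 − err) x²`, `u = 4πaρλ` (`Y ≤ 12πa³ρ < δ`, `C Y^{1/17} ≤ err`, box condition monotone in `Y`).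
[cite: LSSY2005, Thm. 2.4 (2.35)] -/
theorem cell_lowerBound_quadratic (ha : 0 < a) (hℓ : 0 < ℓ) (hlam : 0 < lam) (hρ : 0 < ρ)
    (hlamℓ : lam = ρ * ℓ ^ 3) (hC : 0 < C) (hC' : 0 < C') (hxlo : 0 < xlo)
    (hT : ∀ m : ℕ, 4 * Real.pi * ((m : ℝ) / ℓ ^ 3) * a ^ 3 / 3 < δ →
      C' * (4 * Real.pi * ((m : ℝ) / ℓ ^ 3) * a ^ 3 / 3) ^ (-(6 : ℝ) / 17) < ℓ / a →
      ENNReal.ofReal (4 * Real.pi * ((m : ℝ) / ℓ ^ 3) * a *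
          (1 - C * (4 * Real.pi * ((m : ℝ) / ℓ ^ 3) * a ^ 3 / 3) ^ ((1 : ℝ) / 17)) * m) ≤
        neumannGroundStateEnergy v m ℓ)
    (hδ9 : 12 * Real.pi * a ^ 3 * ρ < δ)
    (herr : C * (12 * Real.pi * a ^ 3 * ρ) ^ ((1 : ℝ) / 17) ≤ err)
    (hbox : C' * (4 * Real.pi * (xlo * ρ) * a ^ 3 / 3) ^ (-(6 : ℝ) / 17) < ℓ / a)
    {m : ℕ} (hxlo_le : xlo ≤ (m : ℝ) / lam) (hx9 : (m : ℝ) / lam ≤ 9) :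
    ENNReal.ofReal (4 * Real.pi * a * ρ * lam * (1 - err) * ((m : ℝ) / lam) ^ 2) ≤
      neumannGroundStateEnergy v m ℓ := by
  set x : ℝ := (m : ℝ) / lam with hxdef
  have hx0 : 0 ≤ x := by positivity
  have hm : (m : ℝ) = x * lam := by rw [hxdef, div_mul_cancel₀ _ hlam.ne']
  have hmρ : (m : ℝ) / ℓ ^ 3 = x * ρ := by
    rw [hm, hlamℓ]; field_simp
  set Y : ℝ := 4 * Real.pi * (x * ρ) * a ^ 3 / 3 with hYdef
  have hY0 : 0 ≤ Y := by positivity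
  have hY9 : Y ≤ 12 * Real.pi * a ^ 3 * ρ := by
    have : 0 < 4 * Real.pi * ρ * a ^ 3 / 3 := by positivity
    rw [hYdef]; nlinarith
  have hYδ : Y < δ := hY9.trans_lt hδ9
  have hYlo_pos : 0 < 4 * Real.pi * (xlo * ρ) * a ^ 3 / 3 := by positivity
  have hYlo : 4 * Real.pi * (xlo * ρ) * a ^ 3 / 3 ≤ Y := by
    rw [hYdef]; gcongr
  have hboxm : C' * Y ^ (-(6 : ℝ) / 17) < ℓ / a := by
    have h1 : Y ^ (-(6 : ℝ) / 17) ≤ (4 * Real.pi * (xlo * ρ) * a ^ 3 / 3) ^ (-(6 : ℝ) / 17) :=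
      Real.rpow_le_rpow_of_nonpos hYlo_pos hYlo (by norm_num)
    exact (mul_le_mul_of_nonneg_left h1 hC'.le).trans_lt hbox
  have hCY : C * Y ^ ((1 : ℝ) / 17) ≤ err := by
    have h1 : Y ^ ((1 : ℝ) / 17) ≤ (12 * Real.pi * a ^ 3 * ρ) ^ ((1 : ℝ) / 17) :=
      Real.rpow_le_rpow hY0 hY9 (by norm_num)
    exact (mul_le_mul_of_nonneg_left h1 hC.le).trans herr
  have h := hT m
  rw [hmρ] at h
  have h := h hYδ hboxm
  refine le_trans (ENNReal.ofReal_le_ofReal ?_) h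
  have h0 : 0 ≤ 4 * Real.pi * a * ρ * lam * x ^ 2 := by positivity
  rw [hm]
  nlinarith [hCY, h0]

/-- **Superadditive branch.** For `x = m/λ > 8` (and `λ ≥ 1`): with `p = ⌈8λ⌉`, `E₀(m) ≥ ⌊m/p⌋ E₀(p) ≥ (m/2p)·64u(1−err)
≥ 2x·u(1−err)`. [cite: LSSY2005, (2.53), Thm. 2.4 (2.35)] -/
theorem cell_lowerBound_linear (ha : 0 < a) (hℓ : 0 < ℓ) (hlam : 0 < lam) (hρ : 0 < ρ)
    (hlamℓ : lam = ρ * ℓ ^ 3) (hC : 0 < C) (hC' : 0 < C') (hxlo : 0 < xlo)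
    (hT : ∀ m : ℕ, 4 * Real.pi * ((m : ℝ) / ℓ ^ 3) * a ^ 3 / 3 < δ →
      C' * (4 * Real.pi * ((m : ℝ) / ℓ ^ 3) * a ^ 3 / 3) ^ (-(6 : ℝ) / 17) < ℓ / a →
      ENNReal.ofReal (4 * Real.pi * ((m : ℝ) / ℓ ^ 3) * a *
          (1 - C * (4 * Real.pi * ((m : ℝ) / ℓ ^ 3) * a ^ 3 / 3) ^ ((1 : ℝ) / 17)) * m) ≤
        neumannGroundStateEnergy v m ℓ)
    (hSA : ∀ p q r : ℕ, (q : ℝ≥0∞) * neumannGroundStateEnergy v p ℓ ≤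
      neumannGroundStateEnergy v (q * p + r) ℓ)
    (hδ9 : 12 * Real.pi * a ^ 3 * ρ < δ)
    (herr : C * (12 * Real.pi * a ^ 3 * ρ) ^ ((1 : ℝ) / 17) ≤ err) (herr1 : err ≤ 1)
    (hbox : C' * (4 * Real.pi * (xlo * ρ) * a ^ 3 / 3) ^ (-(6 : ℝ) / 17) < ℓ / a)
    (hlam1 : 1 ≤ lam) (hxlo1 : xlo ≤ 1)
    {m : ℕ} (hx8 : 8 < (m : ℝ) / lam) :
    ENNReal.ofReal (4 * Real.pi * a * ρ * lam * (1 - err) * (2 * ((m : ℝ) / lam))) ≤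
      neumannGroundStateEnergy v m ℓ := by
  set p : ℕ := ⌈8 * lam⌉₊ with hpdef
  have hp8 : 8 * lam ≤ (p : ℝ) := Nat.le_ceil _
  have hp9 : (p : ℝ) ≤ 9 * lam := by
    have := Nat.ceil_lt_add_one (show (0 : ℝ) ≤ 8 * lam by positivity)
    rw [← hpdef] at this
    linarith
  have hp_pos : 0 < p := by
    have : (0 : ℝ) < p := by linarith
    exact_mod_cast this
  have hpr : (0 : ℝ) < p := by exact_mod_cast hp_pos
  -- Theorem 2.4 at the block size `p`
  have hA := cell_lowerBound_quadratic ha hℓ hlam hρ hlamℓ hC hC' hxlo hT hδ9 herr hbox (m := p)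
    (by rw [le_div_iff₀ hlam]; nlinarith) (by rw [div_le_iff₀ hlam]; linarith)
  have hu0 : 0 ≤ 4 * Real.pi * a * ρ * lam * (1 - err) := by
    have : 0 ≤ 1 - err := by linarith
    positivity
  have h64 : ENNReal.ofReal (4 * Real.pi * a * ρ * lam * (1 - err) * 64) ≤
      neumannGroundStateEnergy v p ℓ := by
    refine le_trans (ENNReal.ofReal_le_ofReal ?_) hA
    have h8 : (8 : ℝ) ≤ (p : ℝ) / lam := by rw [le_div_iff₀ hlam]; linarith
    have : (64 : ℝ) ≤ ((p : ℝ) / lam) ^ 2 := by nlinarith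
    exact mul_le_mul_of_nonneg_left this hu0
  -- `m ≥ p`, `m = q p + r`, `q ≥ 1`, `m < (q+1) p ≤ 2 q p`
  have hm8 : 8 * lam < (m : ℝ) := by rwa [lt_div_iff₀ hlam] at hx8
  have hpm : p ≤ m := by
    rw [hpdef]; exact Nat.ceil_le.2 hm8.le
  set q : ℕ := m / p with hqdef
  set r : ℕ := m % p with hrdef
  have hqpr : q * p + r = m := by
    have := Nat.div_add_mod m p
    rw [← hqdef, ← hrdef] at this
    linarith [Nat.mul_comm p q]
  have hq1 : 1 ≤ q := Nat.div_pos hpm hp_pos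
  have hrp : r < p := Nat.mod_lt m hp_pos
  have hqr : (1 : ℝ) ≤ q := by exact_mod_cast hq1
  have hmq : (m : ℝ) < 2 * q * p := by
    have h1 : (m : ℝ) = q * p + r := by exact_mod_cast hqpr.symm
    have h2 : (r : ℝ) < p := by exact_mod_cast hrp
    nlinarith
  have hx18 : (m : ℝ) / lam < 18 * q := by
    rw [div_lt_iff₀ hlam]; nlinarith
  -- chain
  have hE : neumannGroundStateEnergy v m ℓ = neumannGroundStateEnergy v (q * p + r) ℓ := by rw [hqpr]
  rw [hE]
  refine le_trans ?_ (hSA p q r)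
  refine le_trans ?_ (by gcongr : (q : ℝ≥0∞) * ENNReal.ofReal (4 * Real.pi * a * ρ * lam * (1 - err) * 64) ≤
    (q : ℝ≥0∞) * neumannGroundStateEnergy v p ℓ)
  rw [← ENNReal.ofReal_natCast q, ← ENNReal.ofReal_mul (by positivity)]
  refine ENNReal.ofReal_le_ofReal ?_
  have : 2 * ((m : ℝ) / lam) ≤ (q : ℝ) * 64 := by linarith
  nlinarith [hu0, this]

/-- **Per-cell bound in gauge form**: for every `m`,
`u(1−err)·g(m/λ) ≤ E₀^N(m, ℓ) + u(1−err)·x_lo²` (cells below `x_lo` are given up at cost `u x_lo²`).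
[cite: LSSY2005, Thm. 2.4 (2.35), (2.53)] -/
theorem cell_lowerBound_gauge (ha : 0 < a) (hℓ : 0 < ℓ) (hlam : 0 < lam) (hρ : 0 < ρ)
    (hlamℓ : lam = ρ * ℓ ^ 3) (hC : 0 < C) (hC' : 0 < C') (hxlo : 0 < xlo)
    (hT : ∀ m : ℕ, 4 * Real.pi * ((m : ℝ) / ℓ ^ 3) * a ^ 3 / 3 < δ →
      C' * (4 * Real.pi * ((m : ℝ) / ℓ ^ 3) * a ^ 3 / 3) ^ (-(6 : ℝ) / 17) < ℓ / a →
      ENNReal.ofReal (4 * Real.pi * ((m : ℝ) / ℓ ^ 3) * a *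
          (1 - C * (4 * Real.pi * ((m : ℝ) / ℓ ^ 3) * a ^ 3 / 3) ^ ((1 : ℝ) / 17)) * m) ≤
        neumannGroundStateEnergy v m ℓ)
    (hSA : ∀ p q r : ℕ, (q : ℝ≥0∞) * neumannGroundStateEnergy v p ℓ ≤
      neumannGroundStateEnergy v (q * p + r) ℓ)
    (hδ9 : 12 * Real.pi * a ^ 3 * ρ < δ)
    (herr : C * (12 * Real.pi * a ^ 3 * ρ) ^ ((1 : ℝ) / 17) ≤ err) (herr1 : err ≤ 1)
    (hbox : C' * (4 * Real.pi * (xlo * ρ) * a ^ 3 / 3) ^ (-(6 : ℝ) / 17) < ℓ / a)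
    (hlam1 : 1 ≤ lam) (hxlo1 : xlo ≤ 1) (m : ℕ) :
    ENNReal.ofReal (4 * Real.pi * a * ρ * lam * (1 - err) * cellGauge ((m : ℝ) / lam)) ≤
      neumannGroundStateEnergy v m ℓ +
        ENNReal.ofReal (4 * Real.pi * a * ρ * lam * (1 - err) * xlo ^ 2) := by
  have hu0 : 0 ≤ 4 * Real.pi * a * ρ * lam * (1 - err) := by
    have : 0 ≤ 1 - err := by linarith
    positivity
  have hx0 : 0 ≤ (m : ℝ) / lam := by positivity
  unfold cellGauge
  split_ifs with h8
  · by_cases hlo : xlo ≤ (m : ℝ) / lam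
    · exact le_add_right (cell_lowerBound_quadratic ha hℓ hlam hρ hlamℓ hC hC' hxlo hT hδ9 herr hbox hlo
        (by linarith))
    · push Not at hlo
      refine le_add_left (ENNReal.ofReal_le_ofReal (mul_le_mul_of_nonneg_left ?_ hu0))
      nlinarith
  · push Not at h8
    exact le_add_right (cell_lowerBound_linear ha hℓ hlam hρ hlamℓ hC hC' hxlo hT hSA hδ9 herr herr1 hbox
      hlam1 hxlo1 h8)

end PerCell

/-! ### Smallness of the parameters in the dilute limit -/

/-- A continuous `f` with `f 0 = 0` is eventually `< b` at `0⁺`, for every `b > 0`. [folklore] -/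
theorem eventually_nhdsGT_lt_of_continuous {f : ℝ → ℝ} (hf : Continuous f) (h0 : f 0 = 0) {b : ℝ}
    (hb : 0 < b) : ∀ᶠ ρ in 𝓝[>] (0 : ℝ), f ρ < b := by
  have h := hf.tendsto 0
  rw [h0] at h
  exact (h.eventually (eventually_lt_nhds hb)).filter_mono nhdsWithin_le_nhds

/-- **Smallness of the cell-profile parameters in the dilute limit.** For fixed positive constants all six side
conditions hold for every sufficiently small `ρ`. [folklore] -/
theorem cellProfileParams_eventually (a C C' : ℝ) {M δ e' : ℝ} (hM : 0 < M) (hδ : 0 < δ) (he' : 0 < e') :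
    ∃ ρ₀ : ℝ, 0 < ρ₀ ∧ ∀ ρ : ℝ, 0 < ρ → ρ < ρ₀ →
      ρ < 1 ∧ Real.sqrt ρ ≤ M ^ 3 ∧ 12 * Real.pi * a ^ 3 * ρ < δ ∧
      C * (12 * Real.pi * a ^ 3 * ρ) ^ ((1 : ℝ) / 17) ≤ e' ∧
      C' * a * ρ ^ ((1 : ℝ) / 8) < M ∧
      (ρ ^ ((1 : ℝ) / 16) / (4 * Real.pi * a ^ 3 / 3)) ^ 2 ≤ e' := by
  -- (the tree's `Literature…BoseGas.exists_pos_forall_of_eventually`, gate dedup)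
  apply exists_pos_forall_of_eventually
  have h1 : ∀ᶠ ρ in 𝓝[>] (0 : ℝ), ρ < 1 :=
    eventually_nhdsGT_lt_of_continuous continuous_id rfl one_pos
  have h2 : ∀ᶠ ρ in 𝓝[>] (0 : ℝ), Real.sqrt ρ < M ^ 3 :=
    eventually_nhdsGT_lt_of_continuous Real.continuous_sqrt Real.sqrt_zero (by positivity)
  have h3 : ∀ᶠ ρ in 𝓝[>] (0 : ℝ), 12 * Real.pi * a ^ 3 * ρ < δ :=
    eventually_nhdsGT_lt_of_continuous (continuous_const.mul continuous_id) (by simp) hδ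
  have h4 : ∀ᶠ ρ in 𝓝[>] (0 : ℝ), C * (12 * Real.pi * a ^ 3 * ρ) ^ ((1 : ℝ) / 17) < e' :=
    eventually_nhdsGT_lt_of_continuous
      (continuous_const.mul ((Real.continuous_rpow_const (by norm_num)).comp
        (continuous_const.mul continuous_id)))
      (by simp) he'
  have h5 : ∀ᶠ ρ in 𝓝[>] (0 : ℝ), C' * a * ρ ^ ((1 : ℝ) / 8) < M :=
    eventually_nhdsGT_lt_of_continuous (continuous_const.mul (Real.continuous_rpow_const (by norm_num)))
      (by simp) hM
  have h6 : ∀ᶠ ρ in 𝓝[>] (0 : ℝ), (ρ ^ ((1 : ℝ) / 16) / (4 * Real.pi * a ^ 3 / 3)) ^ 2 < e' :=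
    eventually_nhdsGT_lt_of_continuous (((Real.continuous_rpow_const (by norm_num)).div_const _).pow 2)
      (by simp) he'
  filter_upwards [h1, h2, h3, h4, h5, h6] with ρ h1 h2 h3 h4 h5 h6
  exact ⟨h1, h2.le, h3, h4.le, h5, h6.le⟩

end Summit.AtomisticToContinuum.BoseEinsteinCondensation.Theorems.BoxCountShadow

end
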